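import Summits.FinalStateConjecture.FinalStateConjecture.Theorems.ExactKerrEndsSettlingAlongCensoredKerrEndsGaugeBorneUpgrade
import Literature.Geometry.Lorentzian.ExactKerrEnd
import HarnessLib

/-!
# Crux `SettlingAlongCensoredKerrEnds` (stmt-FinalStateConjecture-18520), line `wall-cone-sections`:
# the crux BY NAME from ONE member-local stub — a SETTLED WEDGE in a kick-unfolding of the given curve

Line lead, cycle 1 (2026-08-17). The registered skeleton of the line
(`Cruxes/SettlingAlongCensoredKerrEnds/Lines/wall_cone_sections.lean`, crux-strategist s2) had two stubs:
the gauge-borne upgrade GU — LANDED (`stub_gaugeBorneUpgrade`, file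
`…GaugeBorneUpgrade.lean`, p164931) — and the Lipschitz-walls statement PW. This file records the
reduction that is left once GU is a theorem, with PW weakened to the part the composition consumes:

* `settlingAlongCensoredKerrEnds_of_settledWedge (hW) : Theses.ExactKerrEnds.SettlingAlongCensoredKerrEnds`
  — the crux from the WEDGE statement W alone: along every tame curve `F` of admissible data
  (immersed-injective, or constant) whose members off `0` are Kerr-ended and censored there is a tame
  admissible two-parameter unfolding `G` of `F` (`G (t, 0) = F t`), a slope `K` and a box
  `0 < t ≤ t₁`, `s < b₀` whose open wedge `K t < s < b₀` consists of SETTLED data (the Statement's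
  settling clause for every maximal development, verbatim). Proof: the ray `s = (K + 1) t` lies in the
  wedge; run along it by the even corner reparametrisation `t = t₂ c² / (1 + c²)` (both signs of `c`
  visit `t > 0`, `IsTameDataFamily.comp_contDiff`) to get a tame admissible curve through `F 0` with
  settled members off `0`; GU makes it injective and immersed.
* `settledWedge_of_lipschitzWalls : PW → W` — the strategist's registered statement (finitely many
  `K`-Lipschitz walls `s = gᵢ t` through the origin carry every non-settled member of the half-box
  `0 < t ≤ t₁`, `0 < s < b₀`) implies W with the same unfolding, slope and box, because a `K`-Lipschitz
  wall through the origin stays in the cone `|s| ≤ K t` (`ne_wall_of_lt`). So a proof of PW closes W,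
  while a lamination of bounded-slope walls at the corner (which refutes PW's finiteness) does not
  touch W: only an exceptional set reaching the corner `F 0` with vertical tangent in the `(t, s)`-slice
  does.
* (`PW → crux` itself is `settlingAlongCensoredKerrEnds_of_lipschitzWalls`, landed by prover seat 0 in
  `…OfLipschitzWalls.lean`, p165248.)

W is open-problem sized (it contains the large-data settling of the kicked censored Kerr-ended members
above the cone and the non-verticality of the exceptional set at the corner); nothing here claims it.
References: Christodoulou, CQG 16 (1999) A23, p. A24 (exceptional sets left by lines in a fixed space of
data); Angelopoulos–Kehle–Unger, arXiv:2603.10378, Thm 2 (C¹ threshold hypersurfaces in the model);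
Kehle–Unger, arXiv:2402.10190, §1.4; Dafermos–Rodnianski, arXiv:0811.0354, App. B.2.3 (the weights).
-/

-- the doubled `FinalStateConjecture.FinalStateConjecture` path component trips dupNamespace
set_option linter.dupNamespace false

noncomputable section

open Set Function Filter Topology TopologicalSpace
open scoped ENNReal NNReal Topology Manifold ContDiff

namespace Summit.FinalStateConjecture.FinalStateConjecture.Theorems.ExactKerrEnds

open Literature.Geometry.Lorentzian

namespace WallConeSections

/-! ### The cone ray (real analysis) -/

-- Private copies of the corner-map lemmas of `…OfLipschitzWalls.lean` (p165248, `WallConeSections.contDiff_corner`,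
-- `corner_pos`, `corner_lt`), kept local so that this file does not depend on that module's build.

/-- The even corner reparametrisation `x ↦ t₂ · x² / (1 + x²)` is smooth. -/
private theorem contDiff_corner' (t₂ : ℝ) : ContDiff ℝ ∞ (fun x : ℝ ↦ t₂ * (x ^ 2 / (1 + x ^ 2))) := by
  refine contDiff_const.mul (ContDiff.div (contDiff_id.pow 2) (contDiff_const.add (contDiff_id.pow 2)) ?_)
  intro x
  positivity

/-- The corner map is positive off `0` (for `t₂ > 0`). -/
private theorem corner_pos' {t₂ x : ℝ} (ht₂ : 0 < t₂) (hx : x ≠ 0) : 0 < t₂ * (x ^ 2 / (1 + x ^ 2)) := by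
  have hx2 : 0 < x ^ 2 := by positivity
  positivity

/-- The corner map stays below `t₂` (for `t₂ > 0`). -/
private theorem corner_lt' {t₂ : ℝ} (ht₂ : 0 < t₂) (x : ℝ) : t₂ * (x ^ 2 / (1 + x ^ 2)) < t₂ := by
  have h1 : x ^ 2 / (1 + x ^ 2) < 1 := by
    rw [div_lt_one (by positivity)]
    linarith [sq_nonneg x]
  calc t₂ * (x ^ 2 / (1 + x ^ 2)) < t₂ * 1 := by exact mul_lt_mul_of_pos_left h1 ht₂
    _ = t₂ := mul_one t₂

/-- **Inside the cone.** A `K`-Lipschitz function through the origin satisfies `g t ≤ K t` for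
`t > 0`; so every `s > K t` is off the wall `s = g t`. -/
theorem ne_wall_of_lt {K : ℝ≥0} {g : ℝ → ℝ} (hg : LipschitzWith K g) (hg0 : g 0 = 0) {t s : ℝ}
    (ht : 0 < t) (hs : (K : ℝ) * t < s) : s ≠ g t := by
  have h := hg.dist_le_mul t 0
  rw [hg0, Real.dist_eq, Real.dist_eq, sub_zero, sub_zero, abs_of_pos ht] at h
  have h' : g t ≤ (K : ℝ) * t := le_trans (le_abs_self _) h
  intro heq
  rw [← heq] at h'
  exact absurd (lt_of_le_of_lt h' hs) (lt_irrefl _)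

end WallConeSections

open WallConeSections

/-! ### W ⇒ the crux (by name) -/

/-- **`SettlingAlongCensoredKerrEnds` from a settled wedge in a kick-unfolding of the given curve.**
Hypothesis W (the registered stub `stub_settledWedgeInKickUnfolding` of line `wall-cone-sections`,
verbatim): for every `X`, end `e` and tame curve `F` of admissible data on `e`, immersed-injective or
constant, whose members off `0` are Kerr-ended (`HasExactKerrEnd`) and censored, there are an end
`e'`, a tame admissible two-parameter family `G` on `e'` with `G (t • e₀ + 0 • e₁) = F t`, a slope
`K : ℝ≥0` and `0 < t₁`, `0 < b₀` such that every member `G (t • e₀ + s • e₁)` with `0 < t ≤ t₁`,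
`K t < s < b₀` satisfies the Statement's settling clause for every maximal vacuum Cauchy development.
Conclusion: the route decl `Theses.ExactKerrEnds.SettlingAlongCensoredKerrEnds` BY NAME. The cone ray
`s = (K + 1) t`, `t = t₂ (c 0)² / (1 + (c 0)²)` with `t₂ := min t₁ (b₀ / (2 (K + 1)))`, is a smooth map
`ℝ¹ → ℝ²` vanishing at `0` with values in the wedge off `0`; `H c := G (ray c)` is tame
(`IsTameDataFamily.comp_contDiff`), admissible, through `F 0`, settled off `0`; the landed gauge-borne
upgrade `stub_gaugeBorneUpgrade` (p164931) makes it injective and immersed. -/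
theorem settlingAlongCensoredKerrEnds_of_settledWedge
    (hW :
    ∀ (X : Type) [TopologicalSpace X] [ChartedSpace E3 X] [IsManifold (𝓡 3) ∞ X] [T2Space X]
      [SecondCountableTopology X] [ConnectedSpace X],
      ∀ (e : AFEnd X) (F : EuclideanSpace ℝ (Fin 1) → InitialDataSet (𝓡 3) X),
        InitialDataSet.IsTameDataFamily e 1 F →
          ((InitialDataSet.IsImmersedAtZero 1 F ∧ Injective F) ∨ ∀ c, F c = F 0) →
            (∀ c, F c ∈ admissibleVacuumData X) →
              (∀ c ≠ 0, (F c).HasExactKerrEnd ∧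
                ∀ 𝒟 : VacuumCauchyDevelopment (F c), 𝒟.IsMaximal →
                  Summit.FinalStateConjecture.HasCompleteNullInfinity 𝒟.toCauchyDevelopment) →
                ∃ (e' : AFEnd X) (G : EuclideanSpace ℝ (Fin 2) → InitialDataSet (𝓡 3) X)
                  (K : ℝ≥0) (t₁ b₀ : ℝ),
                  InitialDataSet.IsTameDataFamily e' 2 G ∧
                    (∀ c : EuclideanSpace ℝ (Fin 1),
                      G ((c 0) • EuclideanSpace.single 0 (1 : ℝ) +
                          (0 : ℝ) • EuclideanSpace.single 1 (1 : ℝ)) = F c) ∧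
                    (∀ p, G p ∈ admissibleVacuumData X) ∧ 0 < t₁ ∧ 0 < b₀ ∧
                    ∀ t ∈ Ioc (0 : ℝ) t₁, ∀ s : ℝ, (K : ℝ) * t < s → s < b₀ →
                      ∀ 𝒟 : VacuumCauchyDevelopment
                          (G (t • EuclideanSpace.single 0 (1 : ℝ) + s • EuclideanSpace.single 1 (1 : ℝ))),
                        𝒟.IsMaximal →
                          Summit.FinalStateConjecture.HasCompleteNullInfinity 𝒟.toCauchyDevelopment ∧
                            ∃ (O : Set 𝒟.carrier) (d : FinalStateDecomposition 𝒟.toSpacetime O 2),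
                              (∀ i, Kerr.IsSubextremal (d.mass i) (d.spin i)) ∧
                                O = Summit.FinalStateConjecture.exteriorOf 𝒟.toCauchyDevelopment
                                      d.charted ∧
                                  Summit.FinalStateConjecture.RaysStayInClosure
                                      𝒟.toCauchyDevelopment O ∧
                                    Summit.FinalStateConjecture.HasExhaustiveCharts d ∧
                                      Summit.FinalStateConjecture.IsFutureOriented d) :
    Summit.FinalStateConjecture.FinalStateConjecture.Theses.ExactKerrEnds.SettlingAlongCensoredKerrEnds := by
  intro X _ _ _ _ _ _ KerrEnded Censored Settled e F hF hdich h𝓓 hQ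
  -- the members off `0` of `F` are Kerr-ended (legend = `HasExactKerrEnd`, definitionally) and censored
  have hQ' : ∀ c ≠ 0, (F c).HasExactKerrEnd ∧
      ∀ 𝒟 : VacuumCauchyDevelopment (F c), 𝒟.IsMaximal →
        Summit.FinalStateConjecture.HasCompleteNullInfinity 𝒟.toCauchyDevelopment := fun c hc ↦
    ⟨(InitialDataSet.hasExactKerrEnd_iff (F c)).2 (hQ c hc).1, (hQ c hc).2⟩
  -- W: the unfolding, the slope, the box
  obtain ⟨e', G, K, t₁, b₀, hG, hGF, hGadm, ht₁, hb₀, hgood⟩ := hW X e F hF hdich h𝓓 hQ'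
  -- the cone ray `s = (K+1) t`, `t = t₂ x²/(1+x²)`
  set κ : ℝ := (K : ℝ) + 1 with hκ
  have hκpos : 0 < κ := by rw [hκ]; positivity
  set t₂ : ℝ := min t₁ (b₀ / (2 * κ)) with ht₂
  have ht₂pos : 0 < t₂ := lt_min ht₁ (by positivity)
  have ht₂le : t₂ ≤ t₁ := min_le_left _ _
  have ht₂b : κ * t₂ ≤ b₀ / 2 := by
    have : t₂ ≤ b₀ / (2 * κ) := min_le_right _ _
    calc κ * t₂ ≤ κ * (b₀ / (2 * κ)) := by exact mul_le_mul_of_nonneg_left this hκpos.le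
      _ = b₀ / 2 := by field_simp
  -- the even corner reparametrisation `θ x = t₂ x² / (1 + x²)`
  let θ : ℝ → ℝ := fun x ↦ t₂ * (x ^ 2 / (1 + x ^ 2))
  have hθ0 : θ 0 = 0 := by simp [θ]
  let ray : EuclideanSpace ℝ (Fin 1) → EuclideanSpace ℝ (Fin 2) := fun c ↦
    (θ (c 0)) • EuclideanSpace.single 0 (1 : ℝ) +
      (κ * θ (c 0)) • EuclideanSpace.single 1 (1 : ℝ)
  have h0 : ContDiff ℝ ∞ (fun c : EuclideanSpace ℝ (Fin 1) ↦ c 0) :=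
    (EuclideanSpace.proj (0 : Fin 1) : EuclideanSpace ℝ (Fin 1) →L[ℝ] ℝ).contDiff
  have hφ : ContDiff ℝ ∞ (fun c : EuclideanSpace ℝ (Fin 1) ↦ θ (c 0)) :=
    (contDiff_corner' t₂).comp h0
  have hray : ContDiff ℝ ∞ ray :=
    (hφ.smul contDiff_const).add ((contDiff_const.mul hφ).smul contDiff_const)
  have hray0 : ray 0 = 0 := by
    simp [ray, hθ0]
  -- the handed-over (not yet immersed) curve
  let H : EuclideanSpace ℝ (Fin 1) → InitialDataSet (𝓡 3) X := fun c ↦ G (ray c)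
  have hH : InitialDataSet.IsTameDataFamily e' 1 H := hG.comp_contDiff hray hray0
  have hH0 : H 0 = F 0 := by
    have h1 : H 0 = G 0 := by simp only [H, hray0]
    have h2 := hGF 0
    have h3 : ((0 : EuclideanSpace ℝ (Fin 1)) 0) • EuclideanSpace.single (0 : Fin 2) (1 : ℝ) +
        (0 : ℝ) • EuclideanSpace.single (1 : Fin 2) (1 : ℝ) = 0 := by simp
    rw [h3] at h2
    exact h1.trans h2
  have hHadm : ∀ c, H c ∈ admissibleVacuumData X := fun c ↦ hGadm _
  have hHgood : ∀ c ≠ 0, ∀ 𝒟 : VacuumCauchyDevelopment (H c), 𝒟.IsMaximal →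
      Summit.FinalStateConjecture.HasCompleteNullInfinity 𝒟.toCauchyDevelopment ∧
        ∃ (O : Set 𝒟.carrier) (d : FinalStateDecomposition 𝒟.toSpacetime O 2),
          (∀ i, Kerr.IsSubextremal (d.mass i) (d.spin i)) ∧
            O = Summit.FinalStateConjecture.exteriorOf 𝒟.toCauchyDevelopment d.charted ∧
              Summit.FinalStateConjecture.RaysStayInClosure 𝒟.toCauchyDevelopment O ∧
                Summit.FinalStateConjecture.HasExhaustiveCharts d ∧
                  Summit.FinalStateConjecture.IsFutureOriented d := by
    intro c hc
    have hc0 : c 0 ≠ 0 := by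
      intro h
      apply hc
      ext i
      rw [Subsingleton.elim i 0, h]
      rfl
    have htpos : 0 < θ (c 0) := corner_pos' ht₂pos hc0
    have htlt : θ (c 0) < t₂ := corner_lt' ht₂pos (c 0)
    have htmem : θ (c 0) ∈ Ioc (0 : ℝ) t₁ := ⟨htpos, (htlt.le.trans ht₂le)⟩
    have hKs : (K : ℝ) * θ (c 0) < κ * θ (c 0) := by
      apply mul_lt_mul_of_pos_right _ htpos
      rw [hκ]
      linarith
    have hslt : κ * θ (c 0) < b₀ := by
      have : κ * θ (c 0) < κ * t₂ := mul_lt_mul_of_pos_left htlt hκpos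
      linarith
    exact hgood _ htmem _ hKs hslt
  -- GU (landed): immersion and injectivity are gauge-borne
  obtain ⟨e'', F', hF', hF'0, hinj, himm, hadm', hgood'⟩ :=
    stub_gaugeBorneUpgrade X e' H hH hHadm hHgood
  exact ⟨e'', F', hF', hF'0.trans hH0, hinj, himm, hadm', fun c hc ↦ hgood' c hc⟩

/-! ### PW ⇒ W -/

/-- **The strategist's Lipschitz-walls statement PW implies the wedge statement W.** PW
(`stub_lipschitzWallsInKickUnfolding` of `Lines/wall_cone_sections.lean`, verbatim): the unfolding,
finitely many `K`-Lipschitz walls `s = g i t` with `g i 0 = 0`, and a half-box `0 < t ≤ t₁`,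
`0 < s < b₀` all of whose members off the walls are settled. W with the same `G`, `K`, `t₁`, `b₀`:
a point of the wedge `K t < s < b₀`, `t > 0`, has `s > 0` and is off every wall (`ne_wall_of_lt`). -/
theorem settledWedge_of_lipschitzWalls
    (hPW :
    ∀ (X : Type) [TopologicalSpace X] [ChartedSpace E3 X] [IsManifold (𝓡 3) ∞ X] [T2Space X]
      [SecondCountableTopology X] [ConnectedSpace X],
      ∀ (e : AFEnd X) (F : EuclideanSpace ℝ (Fin 1) → InitialDataSet (𝓡 3) X),
        InitialDataSet.IsTameDataFamily e 1 F →
          ((InitialDataSet.IsImmersedAtZero 1 F ∧ Injective F) ∨ ∀ c, F c = F 0) →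
            (∀ c, F c ∈ admissibleVacuumData X) →
              (∀ c ≠ 0, (F c).HasExactKerrEnd ∧
                ∀ 𝒟 : VacuumCauchyDevelopment (F c), 𝒟.IsMaximal →
                  Summit.FinalStateConjecture.HasCompleteNullInfinity 𝒟.toCauchyDevelopment) →
                ∃ (e' : AFEnd X) (G : EuclideanSpace ℝ (Fin 2) → InitialDataSet (𝓡 3) X)
                  (n : ℕ) (g : Fin n → ℝ → ℝ) (K : ℝ≥0) (t₁ b₀ : ℝ),
                  InitialDataSet.IsTameDataFamily e' 2 G ∧
                    (∀ c : EuclideanSpace ℝ (Fin 1),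
                      G ((c 0) • EuclideanSpace.single 0 (1 : ℝ) +
                          (0 : ℝ) • EuclideanSpace.single 1 (1 : ℝ)) = F c) ∧
                    (∀ p, G p ∈ admissibleVacuumData X) ∧
                    (∀ i, LipschitzWith K (g i)) ∧ (∀ i, g i 0 = 0) ∧ 0 < t₁ ∧ 0 < b₀ ∧
                    ∀ t ∈ Ioc (0 : ℝ) t₁, ∀ s : ℝ, 0 < s → s < b₀ → (∀ i, s ≠ g i t) →
                      ∀ 𝒟 : VacuumCauchyDevelopment
                          (G (t • EuclideanSpace.single 0 (1 : ℝ) + s • EuclideanSpace.single 1 (1 : ℝ))),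
                        𝒟.IsMaximal →
                          Summit.FinalStateConjecture.HasCompleteNullInfinity 𝒟.toCauchyDevelopment ∧
                            ∃ (O : Set 𝒟.carrier) (d : FinalStateDecomposition 𝒟.toSpacetime O 2),
                              (∀ i, Kerr.IsSubextremal (d.mass i) (d.spin i)) ∧
                                O = Summit.FinalStateConjecture.exteriorOf 𝒟.toCauchyDevelopment
                                      d.charted ∧
                                  Summit.FinalStateConjecture.RaysStayInClosure
                                      𝒟.toCauchyDevelopment O ∧
                                    Summit.FinalStateConjecture.HasExhaustiveCharts d ∧
                                      Summit.FinalStateConjecture.IsFutureOriented d) :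
    ∀ (X : Type) [TopologicalSpace X] [ChartedSpace E3 X] [IsManifold (𝓡 3) ∞ X] [T2Space X]
      [SecondCountableTopology X] [ConnectedSpace X],
      ∀ (e : AFEnd X) (F : EuclideanSpace ℝ (Fin 1) → InitialDataSet (𝓡 3) X),
        InitialDataSet.IsTameDataFamily e 1 F →
          ((InitialDataSet.IsImmersedAtZero 1 F ∧ Injective F) ∨ ∀ c, F c = F 0) →
            (∀ c, F c ∈ admissibleVacuumData X) →
              (∀ c ≠ 0, (F c).HasExactKerrEnd ∧
                ∀ 𝒟 : VacuumCauchyDevelopment (F c), 𝒟.IsMaximal →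
                  Summit.FinalStateConjecture.HasCompleteNullInfinity 𝒟.toCauchyDevelopment) →
                ∃ (e' : AFEnd X) (G : EuclideanSpace ℝ (Fin 2) → InitialDataSet (𝓡 3) X)
                  (K : ℝ≥0) (t₁ b₀ : ℝ),
                  InitialDataSet.IsTameDataFamily e' 2 G ∧
                    (∀ c : EuclideanSpace ℝ (Fin 1),
                      G ((c 0) • EuclideanSpace.single 0 (1 : ℝ) +
                          (0 : ℝ) • EuclideanSpace.single 1 (1 : ℝ)) = F c) ∧
                    (∀ p, G p ∈ admissibleVacuumData X) ∧ 0 < t₁ ∧ 0 < b₀ ∧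
                    ∀ t ∈ Ioc (0 : ℝ) t₁, ∀ s : ℝ, (K : ℝ) * t < s → s < b₀ →
                      ∀ 𝒟 : VacuumCauchyDevelopment
                          (G (t • EuclideanSpace.single 0 (1 : ℝ) + s • EuclideanSpace.single 1 (1 : ℝ))),
                        𝒟.IsMaximal →
                          Summit.FinalStateConjecture.HasCompleteNullInfinity 𝒟.toCauchyDevelopment ∧
                            ∃ (O : Set 𝒟.carrier) (d : FinalStateDecomposition 𝒟.toSpacetime O 2),
                              (∀ i, Kerr.IsSubextremal (d.mass i) (d.spin i)) ∧
                                O = Summit.FinalStateConjecture.exteriorOf 𝒟.toCauchyDevelopment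
                                      d.charted ∧
                                  Summit.FinalStateConjecture.RaysStayInClosure
                                      𝒟.toCauchyDevelopment O ∧
                                    Summit.FinalStateConjecture.HasExhaustiveCharts d ∧
                                      Summit.FinalStateConjecture.IsFutureOriented d := by
  intro X _ _ _ _ _ _ e F hF hdich h𝓓 hQ
  obtain ⟨e', G, n, g, K, t₁, b₀, hG, hGF, hGadm, hg, hg0, ht₁, hb₀, hgood⟩ :=
    hPW X e F hF hdich h𝓓 hQ
  refine ⟨e', G, K, t₁, b₀, hG, hGF, hGadm, ht₁, hb₀, fun t ht s hKs hsb ↦ ?_⟩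
  have hspos : 0 < s := lt_of_le_of_lt (mul_nonneg K.coe_nonneg ht.1.le) hKs
  exact hgood t ht s hspos hsb (fun i ↦ ne_wall_of_lt (hg i) (hg0 i) ht.1 hKs)

end Summit.FinalStateConjecture.FinalStateConjecture.Theorems.ExactKerrEnds

end
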